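import Summits.QuantumFields.YangMills.Theorems.LuscherReductionRunningReductionLatticeLargeField
import Summits.QuantumFields.YangMills.Theorems.LuscherReductionOneSiteLevelsVariational
import Summits.QuantumFields.YangMills.Theorems.FemtoTransferGapSlabRayleigh
import Summits.QuantumFields.YangMills.Theorems.LuscherReductionOneSiteLevelsIMS
import HarnessLib

/-!
# Crux `FixedLatticeLaw` (stmt-QuantumFields-23943 ≡ leaf `FemtoGapFixedLattice`), flat-tube split — the OFF-TUBE KERNEL BOUND and the
# ground-state tail mass (towards K2 = `FlatTubeReduction.OffTubeSuppression`, stmt-QuantumFields-24721)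

Seat `ym-line-fcl-p3` g2 (2026-08-28; explicit-unit prover of route `FemtoCutoffLadder`).  Rung R2b1 = RECORD-label femto transfer gap: NOT infinite
volume, NOT the Clay mass gap, no summit.

K2 of the planner's flat-tube split (route `FlatTubeReduction`, glue landed as `femtoGapFixedLattice_of_nearFlat_offTube`) says: every physical
`ψ ⊥ Ω` is dominated, up to `(λ_b³/L)·λ₀·‖ψ‖²`, by a tube-supported physical `ψ' ⊥ Ω` with `‖ψ'‖ ≤ ‖ψ‖`.  Everything in it flows from ONE kernel
fact, proved here on the `L³` torus with the RED fleet's link-kernel bookkeeping (`latE`, `latCE`, row/column sums, `K_β = E_β·e^{−(β/2)(S(U)+S(V))}`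
of `…RunningReductionLatticeLinkKernel.lean`):

* §1 `isPhys_offCut` / `isPhys_inCut` — the cuts `1_{η<S}·ψ`, `1_{S≤η}·ψ` of a physical `ψ` are physical (`S` is gauge- and twist-invariant);
* §2 ★ `abs_qform_le_of_offTube_left/right` — if `f` (or `φ`) vanishes where `S ≤ η`, then `|⟨f, K_β φ⟩| ≤ e^{−βη/2}·c_β^{|E|}·(‖f‖² + ‖φ‖²)/2`
  (pointwise AM–GM `|f(U)φ(V)| ≤ ½(f(U)² + φ(V)²)`, `K_β(U,V) ≤ E_β(U,V)·e^{−(β/2)S(U)}`, row and column sums of `E_β`);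
* §3 ★ `groundState_offCut_mass_le` — for an exact eigenvector `K_βΩ = λ₀Ω`: `⟨Ω_off, K_βΩ⟩ = λ₀‖Ω_off‖²`, hence
  `‖Ω_off‖² ≤ (e^{−βη/2}c_β^{|E|}/λ₀)·‖Ω‖²` as soon as `e^{−βη/2}c_β^{|E|} ≤ λ₀` — no pointwise eigen-equation, no Agmon estimate;
* §4 `qform_self_le_topValue_mul` — the Rayleigh bound `⟨ψ,K_βψ⟩ ≤ λ₀‖ψ‖²` for every physical `ψ`, and `qform_groundState_right`.

HONEST FRAMING: finite-dimensional-lattice bookkeeping (Schur test with a magnetic floor); no semiclassics, no Born–Oppenheimer (that is K1).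
No definitions, no named facts, no `sorry`.
-/

set_option autoImplicit false

noncomputable section

open MeasureTheory Real
open Literature.MathematicalPhysics.QuantumFieldTheory hiding SU2
open Literature.MathematicalPhysics.QuantumLattice

namespace Summit.QuantumFields.YangMills.Theorems.FemtoCutoffLadder

open Summit.QuantumFields.YangMills.Theorems.FemtoTransferGap

variable {L : ℕ} [NeZero L]

/-! ## §1 Tube cut-offs of physical test functions are physical -/

/-- The Wilson action `S : SU(2)^{E} → ℝ` of the spatial torus is measurable. [folklore] -/
theorem measurable_wilsonAction_su2Lat : Measurable fun U : GaugeConfig 3 L SU2 => wilsonAction su2Rep U := by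
  haveI : SecondCountableTopology SU2 := secondCountableTopology_su2
  exact (FemtoTransferGap.continuous_wilsonAction su2Rep continuous_su2Rep).measurable

/-- The indicator `1_{η < S}` is measurable. [folklore] -/
theorem measurable_offIndicator (η : ℝ) :
    Measurable fun U : GaugeConfig 3 L SU2 => if η < wilsonAction su2Rep U then (1 : ℝ) else 0 :=
  Measurable.ite (measurableSet_lt measurable_const measurable_wilsonAction_su2Lat) measurable_const measurable_const

/-- The indicator `1_{S ≤ η}` (written as `if η < S then 0 else 1`) is measurable. [folklore] -/
theorem measurable_inIndicator (η : ℝ) :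
    Measurable fun U : GaugeConfig 3 L SU2 => if η < wilsonAction su2Rep U then (0 : ℝ) else 1 :=
  Measurable.ite (measurableSet_lt measurable_const measurable_wilsonAction_su2Lat) measurable_const measurable_const

/-- **The OFF-tube cut `1_{η<S}·ψ` of a physical test function is physical** (the Wilson action is gauge- and twist-invariant). [folklore] -/
theorem isPhys_offCut (η : ℝ) {ψ : GaugeConfig 3 L SU2 → ℝ} (hψ : IsPhys ψ) :
    IsPhys fun U => if η < wilsonAction su2Rep U then ψ U else 0 := by
  have h := hψ.mul_of_invariant (measurable_offIndicator (L := L) η) (CJ := 1)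
    (fun U => by
      show |(if η < wilsonAction su2Rep U then (1 : ℝ) else 0)| ≤ 1
      split_ifs <;> simp)
    (fun g U => by
      show (if η < wilsonAction su2Rep (gaugeTransform g U) then (1 : ℝ) else 0) =
        if η < wilsonAction su2Rep U then (1 : ℝ) else 0
      rw [wilsonAction_gaugeTransform])
    (fun k z hz U => by
      show (if η < wilsonAction su2Rep (twist k z U) then (1 : ℝ) else 0) =
        if η < wilsonAction su2Rep U then (1 : ℝ) else 0
      rw [wilsonAction_twist_of_mem_center su2Rep k hz])
  have e : (fun U => if η < wilsonAction su2Rep U then ψ U else 0) =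
      fun U => (if η < wilsonAction su2Rep U then (1 : ℝ) else 0) * ψ U := by
    funext U; split_ifs <;> simp
  rw [e]; exact h

/-- **The IN-tube cut `1_{S≤η}·ψ` of a physical test function is physical.** [folklore] -/
theorem isPhys_inCut (η : ℝ) {ψ : GaugeConfig 3 L SU2 → ℝ} (hψ : IsPhys ψ) :
    IsPhys fun U => if η < wilsonAction su2Rep U then 0 else ψ U := by
  have h := hψ.mul_of_invariant (measurable_inIndicator (L := L) η) (CJ := 1)
    (fun U => by
      show |(if η < wilsonAction su2Rep U then (0 : ℝ) else 1)| ≤ 1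
      split_ifs <;> simp)
    (fun g U => by
      show (if η < wilsonAction su2Rep (gaugeTransform g U) then (0 : ℝ) else 1) =
        if η < wilsonAction su2Rep U then (0 : ℝ) else 1
      rw [wilsonAction_gaugeTransform])
    (fun k z hz U => by
      show (if η < wilsonAction su2Rep (twist k z U) then (0 : ℝ) else 1) =
        if η < wilsonAction su2Rep U then (0 : ℝ) else 1
      rw [wilsonAction_twist_of_mem_center su2Rep k hz])
  have e : (fun U => if η < wilsonAction su2Rep U then 0 else ψ U) =
      fun U => (if η < wilsonAction su2Rep U then (0 : ℝ) else 1) * ψ U := by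
    funext U; split_ifs <;> simp
  rw [e]; exact h

/-! ## §2 The off-tube kernel bound -/

/-- Pointwise: if `f` vanishes where `S ≤ η` then `|f(U) K_β(U,V) φ(V)| ≤ e^{−βη/2}·(½E_β f(U)² + ½E_β φ(V)²)` (`β ≥ 0`; `S(V) ≥ 0`,
`S(U) > η` on the support of `f`, AM–GM). [folklore] -/
theorem offTube_pointwise {β η : ℝ} (hβ : 0 ≤ β) {f : GaugeConfig 3 L SU2 → ℝ}
    (hf : ∀ U, f U ≠ 0 → η < wilsonAction su2Rep U) (φ : GaugeConfig 3 L SU2 → ℝ)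
    (p : GaugeConfig 3 L SU2 × GaugeConfig 3 L SU2) :
    |f p.1 * transferKernel su2Rep β p.1 p.2 * φ p.2| ≤
      Real.exp (-(β * η / 2)) *
        ((1 / 2 : ℝ) * (latE L β p.1 p.2 * f p.1 ^ 2) + (1 / 2 : ℝ) * (latE L β p.1 p.2 * φ p.2 ^ 2)) := by
  have hE := (latE_pos β p.1 p.2).le
  by_cases h0 : f p.1 = 0
  · rw [h0]
    simp only [zero_mul, abs_zero]
    positivity
  · have hU : η < wilsonAction su2Rep p.1 := hf p.1 h0
    have hV : 0 ≤ wilsonAction su2Rep p.2 := wilsonAction_su2_nonneg_lat p.2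
    have hexp : Real.exp (-(β / 2) * (wilsonAction su2Rep p.1 + wilsonAction su2Rep p.2)) ≤ Real.exp (-(β * η / 2)) :=
      Real.exp_le_exp.mpr (by nlinarith)
    have habs : |f p.1 * φ p.2| ≤ (1 / 2 : ℝ) * (f p.1 ^ 2 + φ p.2 ^ 2) := by
      rw [abs_le]; constructor <;> nlinarith [sq_nonneg (f p.1 + φ p.2), sq_nonneg (f p.1 - φ p.2)]
    have hK : 0 ≤ latE L β p.1 p.2 * Real.exp (-(β / 2) * (wilsonAction su2Rep p.1 + wilsonAction su2Rep p.2)) :=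
      mul_nonneg hE (Real.exp_pos _).le
    rw [transferKernel_eq_latE_mul]
    calc |f p.1 * (latE L β p.1 p.2 * Real.exp (-(β / 2) * (wilsonAction su2Rep p.1 + wilsonAction su2Rep p.2))) * φ p.2|
        = |f p.1 * φ p.2| * (latE L β p.1 p.2 * Real.exp (-(β / 2) * (wilsonAction su2Rep p.1 + wilsonAction su2Rep p.2))) := by
          rw [show f p.1 * (latE L β p.1 p.2 * Real.exp (-(β / 2) * (wilsonAction su2Rep p.1 + wilsonAction su2Rep p.2))) * φ p.2
              = (f p.1 * φ p.2) * (latE L β p.1 p.2 *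
                  Real.exp (-(β / 2) * (wilsonAction su2Rep p.1 + wilsonAction su2Rep p.2))) by ring,
            abs_mul, abs_of_nonneg hK]
      _ ≤ ((1 / 2 : ℝ) * (f p.1 ^ 2 + φ p.2 ^ 2)) * (latE L β p.1 p.2 * Real.exp (-(β * η / 2))) :=
          mul_le_mul habs (mul_le_mul_of_nonneg_left hexp hE) hK (by positivity)
      _ = Real.exp (-(β * η / 2)) *
            ((1 / 2 : ℝ) * (latE L β p.1 p.2 * f p.1 ^ 2) + (1 / 2 : ℝ) * (latE L β p.1 p.2 * φ p.2 ^ 2)) := by ring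

/-- ★ **Off-tube kernel bound (support in the FIRST slot)**: if the physical `f` vanishes where `S ≤ η`, then for every physical `φ`
`|⟨f, K_β φ⟩| ≤ e^{−βη/2} · c_β^{|E|} · (‖f‖² + ‖φ‖²)/2` (`β ≥ 0`). [cite: SeilerLNP1982, §3] -/
theorem abs_qform_le_of_offTube_left {β η : ℝ} (hβ : 0 ≤ β) {f φ : GaugeConfig 3 L SU2 → ℝ} (hf : IsPhys f) (hφ : IsPhys φ)
    (hfs : ∀ U, f U ≠ 0 → η < wilsonAction su2Rep U) :
    |qform su2Rep β f φ| ≤ Real.exp (-(β * η / 2)) * latCE L β * (l2 f f + l2 φ φ) / 2 := by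
  haveI : SecondCountableTopology SU2 := secondCountableTopology_su2
  obtain ⟨Cf, hCf⟩ := hf.bounded
  obtain ⟨Cφ, hCφ⟩ := hφ.bounded
  have hfm := hf.measurable
  have hφm := hφ.measurable
  have hq : qform su2Rep β f φ = ∫ p, f p.1 * transferKernel su2Rep β p.1 p.2 * φ p.2
      ∂(configMeasure SU2 L).prod (configMeasure SU2 L) :=
    qform_eq_integral_prod su2Rep continuous_su2Rep β hf hφ
  have hF : Integrable (fun p : GaugeConfig 3 L SU2 × GaugeConfig 3 L SU2 => f p.1 * transferKernel su2Rep β p.1 p.2 * φ p.2)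
      ((configMeasure SU2 L).prod (configMeasure SU2 L)) :=
    integrable_latSandwich (measurable_transferKernel_lat β) (abs_transferKernel_le_lat hβ) hfm hφm hCf hCφ
  have hf2m : Measurable fun U => f U ^ 2 := hfm.pow_const 2
  have hφ2m : Measurable fun U => φ U ^ 2 := hφm.pow_const 2
  have hf2b : ∀ U, |f U ^ 2| ≤ Cf ^ 2 := fun U => by
    rw [abs_pow]; exact pow_le_pow_left₀ (abs_nonneg _) (hCf U) 2
  have hφ2b : ∀ U, |φ U ^ 2| ≤ Cφ ^ 2 := fun U => by
    rw [abs_pow]; exact pow_le_pow_left₀ (abs_nonneg _) (hCφ U) 2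
  have hG1 : Integrable (fun p : GaugeConfig 3 L SU2 × GaugeConfig 3 L SU2 => latE L β p.1 p.2 * f p.1 ^ 2)
      ((configMeasure SU2 L).prod (configMeasure SU2 L)) := by
    refine integrable_latProd ((measurable_latE β).mul (hf2m.comp measurable_fst))
      (C := Real.exp (2 * β) ^ Fintype.card (Edge 3 L) * Cf ^ 2) fun p => ?_
    rw [abs_mul]; exact mul_le_mul (abs_latE_le hβ _ _) (hf2b _) (abs_nonneg _) (by positivity)
  have hG2 : Integrable (fun p : GaugeConfig 3 L SU2 × GaugeConfig 3 L SU2 => latE L β p.1 p.2 * φ p.2 ^ 2)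
      ((configMeasure SU2 L).prod (configMeasure SU2 L)) := by
    refine integrable_latProd ((measurable_latE β).mul (hφ2m.comp measurable_snd))
      (C := Real.exp (2 * β) ^ Fintype.card (Edge 3 L) * Cφ ^ 2) fun p => ?_
    rw [abs_mul]; exact mul_le_mul (abs_latE_le hβ _ _) (hφ2b _) (abs_nonneg _) (by positivity)
  have e1 := integral_prod_latE_mul_fst (L := L) β hf2m hf2b hβ
  have e2 := integral_prod_latE_mul_snd (L := L) β hφ2m hφ2b hβ
  have hl2f : l2 f f = ∫ U, f U ^ 2 ∂configMeasure SU2 L := by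
    unfold l2; congr 1; funext U; ring
  have hl2φ : l2 φ φ = ∫ U, φ U ^ 2 ∂configMeasure SU2 L := by
    unfold l2; congr 1; funext U; ring
  rw [hq]
  calc |∫ p, f p.1 * transferKernel su2Rep β p.1 p.2 * φ p.2 ∂(configMeasure SU2 L).prod (configMeasure SU2 L)|
      ≤ ∫ p, |f p.1 * transferKernel su2Rep β p.1 p.2 * φ p.2| ∂(configMeasure SU2 L).prod (configMeasure SU2 L) :=
        abs_integral_le_integral_abs
    _ ≤ ∫ p, Real.exp (-(β * η / 2)) *
          ((1 / 2 : ℝ) * (latE L β p.1 p.2 * f p.1 ^ 2) + (1 / 2 : ℝ) * (latE L β p.1 p.2 * φ p.2 ^ 2))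
          ∂(configMeasure SU2 L).prod (configMeasure SU2 L) :=
        integral_mono hF.abs (((hG1.const_mul _).add (hG2.const_mul _)).const_mul _) fun p => offTube_pointwise hβ hfs φ p
    _ = Real.exp (-(β * η / 2)) * ((1 / 2 : ℝ) * (latCE L β * ∫ U, f U ^ 2 ∂configMeasure SU2 L) +
          (1 / 2 : ℝ) * (latCE L β * ∫ U, φ U ^ 2 ∂configMeasure SU2 L)) := by
        rw [integral_const_mul, integral_add (hG1.const_mul _) (hG2.const_mul _), integral_const_mul, integral_const_mul, e1, e2]
    _ = Real.exp (-(β * η / 2)) * latCE L β * (l2 f f + l2 φ φ) / 2 := by rw [hl2f, hl2φ]; ring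

/-- ★ **Off-tube kernel bound (support in the SECOND slot)**: if the physical `φ` vanishes where `S ≤ η`, then for every physical `f`
`|⟨f, K_β φ⟩| ≤ e^{−βη/2} · c_β^{|E|} · (‖f‖² + ‖φ‖²)/2` (`β ≥ 0`; symmetry of the `SU(2)` transfer form). [cite: SeilerLNP1982, §3] -/
theorem abs_qform_le_of_offTube_right {β η : ℝ} (hβ : 0 ≤ β) {f φ : GaugeConfig 3 L SU2 → ℝ} (hf : IsPhys f) (hφ : IsPhys φ)
    (hφs : ∀ U, φ U ≠ 0 → η < wilsonAction su2Rep U) :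
    |qform su2Rep β f φ| ≤ Real.exp (-(β * η / 2)) * latCE L β * (l2 f f + l2 φ φ) / 2 := by
  rw [qform_su2Rep_comm β hf hφ, add_comm]
  exact abs_qform_le_of_offTube_left hβ hφ hf hφs

/-! ## §3 The ground-state tail mass off the tube -/

/-- `l2` only sees the pointwise product of its arguments. [folklore] -/
theorem l2_congr_mul {f g f' g' : GaugeConfig 3 L SU2 → ℝ} (h : ∀ U, f U * g U = f' U * g' U) : l2 f g = l2 f' g' := by
  unfold l2
  congr 1
  funext U
  exact h U

/-- `⟨f, K_β Ω⟩ = λ₀·⟨f, Ω⟩` for an exact top eigenvector `K_βΩ = λ₀Ω`. [cite: ReedSimonIV1978, Thm. XIII.43] -/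
theorem qform_groundState_right {β : ℝ} {Ω : GaugeConfig 3 L SU2 → ℝ}
    (heig : transferApply β Ω = topValue su2Rep L β • Ω) (f : GaugeConfig 3 L SU2 → ℝ) :
    qform su2Rep β f Ω = topValue su2Rep L β * l2 f Ω := by
  rw [qform_eq_l2_transferApply, heig, l2_comm, l2_smul_left, l2_comm]

/-- ★ **Tail mass of the ground state off the tube.**  For an exact physical eigenvector `K_βΩ = λ₀Ω` (`β ≥ 0`) and any threshold `η`
with `e^{−βη/2}·c_β^{|E|} ≤ λ₀`: `‖1_{η<S}Ω‖² ≤ (e^{−βη/2}·c_β^{|E|}/λ₀)·‖Ω‖²` — from `⟨Ω_off, K_βΩ⟩ = λ₀⟨Ω_off,Ω⟩ = λ₀‖Ω_off‖²` and the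
off-tube kernel bound. [cite: ReedSimonIV1978, Thm. XIII.43] -/
theorem groundState_offCut_mass_le {β η : ℝ} (hβ : 0 ≤ β) {Ω : GaugeConfig 3 L SU2 → ℝ} (hΩ : IsPhys Ω)
    (heig : transferApply β Ω = topValue su2Rep L β • Ω)
    (hε : Real.exp (-(β * η / 2)) * latCE L β ≤ topValue su2Rep L β) :
    l2 (fun U => if η < wilsonAction su2Rep U then Ω U else 0) (fun U => if η < wilsonAction su2Rep U then Ω U else 0)
      ≤ Real.exp (-(β * η / 2)) * latCE L β / topValue su2Rep L β * l2 Ω Ω := by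
  have hΩo : IsPhys (fun U => if η < wilsonAction su2Rep U then Ω U else 0) := isPhys_offCut η hΩ
  have hsupp : ∀ U, (fun U => if η < wilsonAction su2Rep U then Ω U else 0) U ≠ 0 → η < wilsonAction su2Rep U := by
    intro U hU
    by_contra h
    exact hU (by simp [h])
  have hpos : 0 < topValue su2Rep L β := topValue_su2Rep_pos L β
  have h1 : qform su2Rep β (fun U => if η < wilsonAction su2Rep U then Ω U else 0) Ω =
      topValue su2Rep L β *
        l2 (fun U => if η < wilsonAction su2Rep U then Ω U else 0) (fun U => if η < wilsonAction su2Rep U then Ω U else 0) := by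
    rw [qform_groundState_right heig]
    congr 1
    refine l2_congr_mul fun U => ?_
    show (if η < wilsonAction su2Rep U then Ω U else 0) * Ω U =
      (if η < wilsonAction su2Rep U then Ω U else 0) * (if η < wilsonAction su2Rep U then Ω U else 0)
    split_ifs <;> simp
  have h2 := abs_qform_le_of_offTube_left hβ hΩo hΩ hsupp
  have h3 : topValue su2Rep L β *
      l2 (fun U => if η < wilsonAction su2Rep U then Ω U else 0) (fun U => if η < wilsonAction su2Rep U then Ω U else 0) ≤
      Real.exp (-(β * η / 2)) * latCE L β *
        (l2 (fun U => if η < wilsonAction su2Rep U then Ω U else 0) (fun U => if η < wilsonAction su2Rep U then Ω U else 0)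
          + l2 Ω Ω) / 2 := by
    rw [← h1]; exact (le_abs_self _).trans h2
  have hx : 0 ≤ l2 (fun U => if η < wilsonAction su2Rep U then Ω U else 0)
      (fun U => if η < wilsonAction su2Rep U then Ω U else 0) := l2_self_nonneg _
  have hy : 0 ≤ l2 Ω Ω := l2_self_nonneg _
  have hε0 : 0 ≤ Real.exp (-(β * η / 2)) * latCE L β := mul_nonneg (Real.exp_pos _).le (latCE_pos hβ).le
  rw [div_mul_eq_mul_div, le_div_iff₀ hpos]
  nlinarith [h3, hε, hx, hy, hε0, mul_le_mul_of_nonneg_right hε hx]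

/-! ## §4 The Rayleigh bound -/

/-- **`⟨ψ, K_βψ⟩ ≤ λ₀‖ψ‖²` for every physical `ψ`** (if `‖ψ‖² = 0`, Cauchy–Schwarz against `K_βψ` gives `⟨ψ,K_βψ⟩ = 0`).
[cite: ReedSimonIV1978, Thm. XIII.1] -/
theorem qform_self_le_topValue_mul (β : ℝ) {ψ : GaugeConfig 3 L SU2 → ℝ} (hψ : IsPhys ψ) :
    qform su2Rep β ψ ψ ≤ topValue su2Rep L β * l2 ψ ψ := by
  rw [← levelValue_zero su2Rep L β]
  rcases (l2_self_nonneg ψ).eq_or_lt with h0 | hpos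
  · have hK := isPhys_transferApply (L := L) β hψ
    have hcs := sq_l2_le hψ hK
    rw [← h0, zero_mul] at hcs
    have hz : l2 ψ (transferApply β ψ) = 0 := pow_eq_zero_iff two_ne_zero |>.mp (le_antisymm hcs (sq_nonneg _))
    rw [qform_eq_l2_transferApply, hz, ← h0, mul_zero]
  · exact qform_le_levelValue_zero_mul su2Rep continuous_su2Rep β hψ hpos

end Summit.QuantumFields.YangMills.Theorems.FemtoCutoffLadder

end
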